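import Literature.Analysis.FluidPDE.CorrectorFourierEstimates
import HarnessLib

/-!
# Picard iteration for the Fourier-transformed system (3.2) on short intervals

Analysis/FluidPDE proof file, third of the files discharging
`Literature.Analysis.FluidPDE.Torus.CheskidovLuo2022LocalExistence` (objects in
`CorrectorFourierDefs`, symbol estimates in `CorrectorFourierEstimates`; Cheskidov–Luo 2022,
§3.1: "for all sufficiently small `τ > 0`, we may solve equation (3.2) on intervals
`[tᵢ, tᵢ₊₁]`", with the smallness of Prop. 3.2). The mild form of (3.2) with zero datum,

  `c(l, t, k) = -∫₀ᵗ e^{-4π²|k|²(t-s)} (P G)(U(s), R̂(s), c(s))(l, k) ds`,  `0 ≤ t ≤ θ`,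

is solved by Picard iteration from `c₀ = 0` in the ball
`{sup_{l,t} (1 + ‖k‖)^{2#d+1} ‖c(l,t,k)‖ ≤ ρ}` of the base order `2#d + 1`, for intervals of
length `θ ≤ θ₀(ρ, data)`: the projected symbol loses one derivative
(`hasDecay_projSym_of_convSym`) and the heat factor regains it at the price `√θ`
(`norm_duhamel_gain`: `(1+‖k‖) ‖∫₀^τ e^{-4π²|k|²(τ-s)} F‖ ≤ e·E·√θ · sup ‖F‖`, from the tree's
`ScalarFourier.heat_weight_gain` with the weight `λ = 1/θ`), so the Duhamel map sends the ball
to itself and contracts by `1/2` once `√θ` is small against the (quadratic in `ρ`) symbol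
constants (`exists_threshold`). The limit `c = picardLim` is continuous in time, lies in the
ball, is the fixed point `c = Φ(c)` and vanishes at `t = 0` (`iter_tendsto`,
`continuous_picardLim`, `picardLim_eq_picardMap`, `picardLim_zero_time`). Higher-order decay,
time regularity, symmetries and the synthesis are in the sequel files.

## References

* A. Cheskidov, X. Luo, arXiv:2009.06596, §3.1 (3.2), Prop. 3.2. [`CheskidovLuo2022`]
* P. G. Lemarié-Rieusset, *The Navier–Stokes problem in the 21st century*, CRC 2016, §8.5.
* J. Leray, Acta Math. 63 (1934), §19 (successive approximations). [`Leray1934`]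
-/

noncomputable section

open MeasureTheory Real Set Filter Topology UnitAddTorus

namespace Literature.Analysis.FluidPDE

namespace CorrectorFourier

open ScalarFourier
open FourierNS (HasDecay clamp)
open Literature.Analysis.FunctionSpaces.Torus (freqNormSq)

variable {d : Type*} [Fintype d] [DecidableEq d]

/-! ### The Duhamel integral regains one derivative at the price `√θ` -/

section Gain

/-- **Heat gain on short intervals.** For `0 < θ ≤ 1`, `τ ∈ [0, θ]` and an integrand bounded by
`M` on `[0, τ]`: `(1 + ‖k‖) ‖∫₀^τ e^{-4π²|k|²(τ-s)} F(s) ds‖ ≤ M · e · E · √θ` with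
`E = 1 + 1/(2√(4π²))` (`ScalarFourier.heat_weight_gain` with the weight `λ = 1/θ`, for which
`e^{λτ} ≤ e` and `1/√λ = √θ`). [folklore] -/
theorem norm_duhamel_gain {θ : ℝ} (hθ : 0 < θ) (hθ1 : θ ≤ 1) {τ : ℝ} (hτ : τ ∈ Icc 0 θ)
    {F : ℝ → ℂ} {M : ℝ} (hM : 0 ≤ M) (hbound : ∀ s ∈ Icc 0 τ, ‖F s‖ ≤ M) (k : d → ℤ) :
    (1 + ‖k‖) * ‖∫ s in (0 : ℝ)..τ, (heatFactor 1 k (τ - s) : ℂ) * F s‖ ≤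
      M * (Real.exp 1 * (1 + 1 / (2 * Real.sqrt (4 * π ^ 2 * 1))) * Real.sqrt θ) := by
  set lam : ℝ := 1 / θ with hlam
  have hlam1 : 1 ≤ lam := by rw [hlam, le_div_iff₀ hθ, one_mul]; exact hθ1
  have hb : ∀ s ∈ Icc 0 τ, ‖F s‖ ≤ M * Real.exp (lam * s) := fun s hs =>
    (hbound s hs).trans (le_mul_of_one_le_right hM (Real.one_le_exp (by
      have : 0 ≤ lam := by linarith
      exact mul_nonneg this hs.1)))
  have h1 := norm_duhamel_le (1 : ℝ) hτ.1 hb k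
  have h2 := heat_weight_gain (d := d) one_pos hlam1 k hτ.1
  have hexp : Real.exp (lam * τ) ≤ Real.exp 1 := by
    refine Real.exp_le_exp.2 ?_
    rw [hlam, one_div, inv_mul_le_iff₀ hθ, mul_one]
    exact hτ.2
  have hsq : Real.sqrt lam = 1 / Real.sqrt θ := by
    rw [hlam, Real.sqrt_div' _ hθ.le, Real.sqrt_one]
  have hsθ : 0 < Real.sqrt θ := Real.sqrt_pos.2 hθ
  have hE : 0 ≤ 1 + 1 / (2 * Real.sqrt (4 * π ^ 2 * 1)) := by positivity
  have hI : 0 ≤ ∫ s in (0 : ℝ)..τ, Real.exp (-(heatRate 1 k) * (τ - s)) * Real.exp (lam * s) :=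
    intervalIntegral.integral_nonneg hτ.1 fun s _ => by positivity
  calc (1 + ‖k‖) * ‖∫ s in (0 : ℝ)..τ, (heatFactor 1 k (τ - s) : ℂ) * F s‖
      ≤ (1 + ‖k‖) * (M * ∫ s in (0 : ℝ)..τ, Real.exp (-(heatRate 1 k) * (τ - s)) * Real.exp (lam * s)) :=
        mul_le_mul_of_nonneg_left h1 (by positivity)
    _ = M * ((1 + ‖k‖) * ∫ s in (0 : ℝ)..τ, Real.exp (-(heatRate 1 k) * (τ - s)) * Real.exp (lam * s)) := by
        ring
    _ ≤ M * (Real.exp (lam * τ) * ((1 + 1 / (2 * Real.sqrt (4 * π ^ 2 * 1))) / Real.sqrt lam)) :=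
        mul_le_mul_of_nonneg_left h2 hM
    _ ≤ M * (Real.exp 1 * ((1 + 1 / (2 * Real.sqrt (4 * π ^ 2 * 1))) / Real.sqrt lam)) := by
        gcongr
    _ = M * (Real.exp 1 * (1 + 1 / (2 * Real.sqrt (4 * π ^ 2 * 1))) * Real.sqrt θ) := by
        rw [hsq]
        field_simp

end Gain

/-! ### The Duhamel map on the ball of the base order -/

section Ball

variable {θ : ℝ} {U : d → ℝ → (d → ℤ) → ℂ} {RH : d → d → ℝ → (d → ℤ) → ℂ}

/-- **The Duhamel map on fields of the base order.** If `c` decays to order `2#d + 1` with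
constant `X` uniformly in `(l, t)`, the drift to the same order with constant `A` and the stress
with constant `B`, then `Φ(c)` decays to order `2#d + 1` with constant `e·E·√θ · 2#d · Cᴳ`, where
`Cᴳ` is the order-`2#d` constant of `convSym` from `hasDecay_convSym`. [folklore] -/
theorem DataHyp.hasDecay_picardMap (h : DataHyp θ U RH) {A B X : ℝ} (hA : 0 ≤ A) (hB : 0 ≤ B)
    (hX : 0 ≤ X) (hU : ∀ j t, HasDecay (latOrder d + 1) A (U j t))
    (hR : ∀ i j t, HasDecay (latOrder d + 1) B (RH i j t)) {c : d → ℝ → (d → ℤ) → ℂ}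
    (hc : ∀ l t, HasDecay (latOrder d + 1) X (c l t)) (l : d) (t : ℝ) :
    HasDecay (latOrder d + 1)
      ((Real.exp 1 * (1 + 1 / (2 * Real.sqrt (4 * π ^ 2 * 1))) * Real.sqrt θ) *
        (2 * Fintype.card d *
          (Fintype.card d * (2 ^ latOrder d * latMass d * (X * (2 * π * X) + X * (2 * π * X))) +
            Fintype.card d * (2 ^ latOrder d * latMass d * (A * (2 * π * X) + A * (2 * π * X))) +
            Fintype.card d * (2 ^ latOrder d * latMass d * (X * (2 * π * A) + X * (2 * π * A))) +
            Fintype.card d * (2 * π * B))))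
      (picardMap θ U RH c l t) := by
  intro k
  have hτ := FourierNS.clamp_mem_Icc h.hθ.le t
  set τ := clamp θ t with hτdef
  set CG := Fintype.card d * (2 ^ latOrder d * latMass d * (X * (2 * π * X) + X * (2 * π * X))) +
      Fintype.card d * (2 ^ latOrder d * latMass d * (A * (2 * π * X) + A * (2 * π * X))) +
      Fintype.card d * (2 ^ latOrder d * latMass d * (X * (2 * π * A) + X * (2 * π * A))) +
      Fintype.card d * (2 * π * B) with hCG
  -- the integrand is bounded by the order-`2#d` constant of the projected symbol
  have hN : ∀ s, HasDecay (latOrder d) (2 * Fintype.card d * CG)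
      (projSym (fun j => U j s) (fun i j => RH i j s) (fun j => c j s) l) := fun s =>
    hasDecay_projSym_of_convSym (fun m => hasDecay_convSym hA hX (fun j => hU j s)
      (fun j => hU j s) (fun j => hc j s) (fun j => hc j s) (fun i j => hR i j s) m) l
  have hCG0 : 0 ≤ CG := by
    have := latMass_nonneg (d := d)
    positivity
  have hM : 0 ≤ 2 * Fintype.card d * CG * ((1 + ‖k‖) ^ latOrder d)⁻¹ := by positivity
  have hgain := norm_duhamel_gain h.hθ h.hθ1 hτ hM (fun s _ => hN s k)
    (F := fun s => projSym (fun j => U j s) (fun i j => RH i j s) (fun j => c j s) l k) k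
  have hw : (0 : ℝ) < 1 + ‖k‖ := by positivity
  have hpow : ((1 + ‖k‖) ^ (latOrder d + 1))⁻¹ = ((1 + ‖k‖) ^ latOrder d)⁻¹ * (1 + ‖k‖)⁻¹ := by
    rw [pow_succ, mul_inv]
  rw [picardMap, norm_neg, hpow]
  rw [← hτdef]
  have key : ‖∫ s in (0 : ℝ)..τ, (heatFactor 1 k (τ - s) : ℂ) *
      projSym (fun j => U j s) (fun i j => RH i j s) (fun j => c j s) l k‖ ≤
      2 * Fintype.card d * CG * ((1 + ‖k‖) ^ latOrder d)⁻¹ *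
        (Real.exp 1 * (1 + 1 / (2 * Real.sqrt (4 * π ^ 2 * 1))) * Real.sqrt θ) * (1 + ‖k‖)⁻¹ := by
    rw [le_mul_inv_iff₀ hw, mul_comm]
    exact hgain
  refine key.trans (le_of_eq ?_)
  ring

/-- The Duhamel integrand `s ↦ e^{-4π²|k|²(τ-s)} (P G)(U(s), RH(s), c(s))(l, k)` is continuous
for fields continuous in time with uniform decay of order `2#d + 1`. [folklore] -/
theorem DataHyp.continuous_integrand (h : DataHyp θ U RH) {A X : ℝ}
    (hU : ∀ j t, HasDecay (latOrder d + 1) A (U j t)) {c : d → ℝ → (d → ℤ) → ℂ}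
    (hcc : ∀ l m, Continuous fun t => c l t m) (hc : ∀ l t, HasDecay (latOrder d + 1) X (c l t))
    (l : d) (k : d → ℤ) (τ : ℝ) :
    Continuous fun s => (heatFactor 1 k (τ - s) : ℂ) *
      projSym (fun j => U j s) (fun i j => RH i j s) (fun j => c j s) l k :=
  (continuous_heatFactor_comp (continuous_const.sub continuous_id) 1 k).mul
    (continuous_projSym_param (Y := ℝ) (fun j m => h.contU j m) (fun i j m => h.contR i j m)
      hcc (fun s j => hU j s) (fun s j => hc j s) l k)

/-- **Continuity of the Duhamel map in time**: `t ↦ Φ(c)(l, t, k)` is continuous when `c` is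
continuous in time with uniform decay of order `2#d + 1` (parametric interval integrals,
Mathlib `intervalIntegral.continuous_parametric_intervalIntegral_of_continuous`). [folklore] -/
theorem DataHyp.continuous_picardMap (h : DataHyp θ U RH) {A X : ℝ}
    (hU : ∀ j t, HasDecay (latOrder d + 1) A (U j t)) {c : d → ℝ → (d → ℤ) → ℂ}
    (hcc : ∀ l m, Continuous fun t => c l t m) (hc : ∀ l t, HasDecay (latOrder d + 1) X (c l t))
    (l : d) (k : d → ℤ) : Continuous fun t => picardMap θ U RH c l t k := by
  have hF : Continuous (Function.uncurry fun (t s : ℝ) => (heatFactor 1 k (clamp θ t - s) : ℂ) *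
      projSym (fun j => U j s) (fun i j => RH i j s) (fun j => c j s) l k) := by
    have hcl : Continuous fun p : ℝ × ℝ => clamp θ p.1 - p.2 :=
      ((FourierNS.continuous_clamp θ).comp continuous_fst).sub continuous_snd
    exact (continuous_heatFactor_comp hcl 1 k).mul
      ((continuous_projSym_param (Y := ℝ) (fun j m => h.contU j m) (fun i j m => h.contR i j m)
        hcc (fun s j => hU j s) (fun s j => hc j s) l k).comp continuous_snd)
  have h2 := intervalIntegral.continuous_parametric_intervalIntegral_of_continuous (μ := volume)
    (a₀ := 0) hF (FourierNS.continuous_clamp θ)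
  exact h2.neg

/-- **Lipschitz estimate of the Duhamel map on the ball.** If `c`, `c'` are continuous in time,
decay to order `2#d + 1` with constant `X`, and their difference with constant `D`, then
`Φ(c) - Φ(c')` decays to order `2#d + 1` with constant `e·E·√θ · L · D`,
`L = 2#d · #d 2^{2#d} latMass 2π (4X + 4A)` (the difference of the symbols is a sum of transport
symbols with exactly one slot carrying `c - c'`, `hasDecay_convSym_sub`). [folklore] -/
theorem DataHyp.hasDecay_picardMap_sub (h : DataHyp θ U RH) {A X D : ℝ} (hA : 0 ≤ A) (hX : 0 ≤ X)
    (hD : 0 ≤ D) (hU : ∀ j t, HasDecay (latOrder d + 1) A (U j t))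
    {c c' : d → ℝ → (d → ℤ) → ℂ} (hcc : ∀ l m, Continuous fun t => c l t m)
    (hcc' : ∀ l m, Continuous fun t => c' l t m)
    (hc : ∀ l t, HasDecay (latOrder d + 1) X (c l t)) (hc' : ∀ l t, HasDecay (latOrder d + 1) X (c' l t))
    (hdiff : ∀ l t, HasDecay (latOrder d + 1) D (fun m => c l t m - c' l t m)) (l : d) (t : ℝ) :
    HasDecay (latOrder d + 1)
      ((Real.exp 1 * (1 + 1 / (2 * Real.sqrt (4 * π ^ 2 * 1))) * Real.sqrt θ) *
        (2 * Fintype.card d *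
          (Fintype.card d * (2 ^ latOrder d * latMass d * (2 * π)) * (4 * X + 4 * A))) * D)
      (fun m => picardMap θ U RH c l t m - picardMap θ U RH c' l t m) := by
  intro k
  have hτ := FourierNS.clamp_mem_Icc h.hθ.le t
  set τ := clamp θ t with hτdef
  -- the difference of the symbols decays to order `2#d` with constant `2#d · CD`
  set CD := Fintype.card d * (2 ^ latOrder d * latMass d * (X * (2 * π * D) + X * (2 * π * D))) +
      Fintype.card d * (2 ^ latOrder d * latMass d * (D * (2 * π * X) + D * (2 * π * X))) +
      Fintype.card d * (2 ^ latOrder d * latMass d * (A * (2 * π * D) + A * (2 * π * D))) +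
      Fintype.card d * (2 ^ latOrder d * latMass d * (D * (2 * π * A) + D * (2 * π * A))) with hCD
  have hCDeq : CD = Fintype.card d * (2 ^ latOrder d * latMass d * (2 * π)) * (4 * X + 4 * A) * D := by
    rw [hCD]; ring
  have hN : ∀ s, HasDecay (latOrder d) (2 * Fintype.card d * CD)
      (fun m => projSym (fun j => U j s) (fun i j => RH i j s) (fun j => c j s) l m -
        projSym (fun j => U j s) (fun i j => RH i j s) (fun j => c' j s) l m) := fun s =>
    hasDecay_projSym_sub (fun m => hasDecay_convSym_sub hA hX hX hD (fun j => hU j s)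
      (fun j => hU j s) (fun j => hc j s) (fun j => hc j s) (fun j => hc' j s) (fun j => hc' j s)
      (fun j => hdiff j s) (fun j => hdiff j s) m) l
  have hCD0 : 0 ≤ CD := by
    have := latMass_nonneg (d := d)
    positivity
  have hM : 0 ≤ 2 * Fintype.card d * CD * ((1 + ‖k‖) ^ latOrder d)⁻¹ := by positivity
  -- the difference of the Duhamel maps is the Duhamel integral of the difference
  set F : ℝ → ℂ := fun s => projSym (fun j => U j s) (fun i j => RH i j s) (fun j => c j s) l k with hF
  set F' : ℝ → ℂ := fun s => projSym (fun j => U j s) (fun i j => RH i j s) (fun j => c' j s) l k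
    with hF'
  have hi := (h.continuous_integrand hU hcc hc l k τ).intervalIntegrable (μ := volume) 0 τ
  have hi' := (h.continuous_integrand hU hcc' hc' l k τ).intervalIntegrable (μ := volume) 0 τ
  have hint : picardMap θ U RH c l t k - picardMap θ U RH c' l t k =
      -∫ s in (0 : ℝ)..τ, (heatFactor 1 k (τ - s) : ℂ) * (F s - F' s) := by
    simp only [picardMap, ← hτdef]
    rw [neg_sub_neg, ← intervalIntegral.integral_sub hi' hi, ← intervalIntegral.integral_neg]
    refine intervalIntegral.integral_congr fun s _ => ?_
    simp only [hF, hF']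
    ring
  have hgain := norm_duhamel_gain h.hθ h.hθ1 hτ hM (fun s _ => hN s k) (F := fun s => F s - F' s) k
  have hw : (0 : ℝ) < 1 + ‖k‖ := by positivity
  have hpow : ((1 + ‖k‖) ^ (latOrder d + 1))⁻¹ = ((1 + ‖k‖) ^ latOrder d)⁻¹ * (1 + ‖k‖)⁻¹ := by
    rw [pow_succ, mul_inv]
  change ‖picardMap θ U RH c l t k - picardMap θ U RH c' l t k‖ ≤ _
  rw [hint, norm_neg, hpow]
  have key : ‖∫ s in (0 : ℝ)..τ, (heatFactor 1 k (τ - s) : ℂ) * (F s - F' s)‖ ≤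
      2 * Fintype.card d * CD * ((1 + ‖k‖) ^ latOrder d)⁻¹ *
        (Real.exp 1 * (1 + 1 / (2 * Real.sqrt (4 * π ^ 2 * 1))) * Real.sqrt θ) * (1 + ‖k‖)⁻¹ := by
    rw [le_mul_inv_iff₀ hw, mul_comm]
    exact hgain
  refine key.trans (le_of_eq ?_)
  rw [hCDeq]
  ring

end Ball

/-! ### The threshold on the interval length and the iteration -/

section Iteration

variable {θ : ℝ} {U : d → ℝ → (d → ℤ) → ℂ} {RH : d → d → ℝ → (d → ℤ) → ℂ}

omit [DecidableEq d] in
/-- **The threshold on the interval length.** For every radius `ρ > 0` and data constants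
`A, B ≥ 0` there is `θ₀ ∈ (0, 1]` such that for all `0 < θ ≤ θ₀` the ball constant and the
Lipschitz constant of the Duhamel map (`hasDecay_picardMap`, `hasDecay_picardMap_sub` with
`X = ρ`) satisfy `e·E·√θ · C_ball ≤ ρ` and `e·E·√θ · L ≤ 1/2` (elementary: `√θ ≤ 1/(M+1)` for
`M = max (eE C_ball/ρ) (2 eE L)`). This is the "sufficiently small `τ`" of Cheskidov–Luo 2022,
§3.1, in terms of the decay constants of the background on the whole time interval. [folklore] -/
theorem exists_threshold {ρ A B : ℝ} (hρ : 0 < ρ) (hA : 0 ≤ A) (hB : 0 ≤ B) :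
    ∃ θ₀ : ℝ, 0 < θ₀ ∧ θ₀ ≤ 1 ∧ ∀ θ : ℝ, 0 < θ → θ ≤ θ₀ →
      (Real.exp 1 * (1 + 1 / (2 * Real.sqrt (4 * π ^ 2 * 1))) * Real.sqrt θ) *
          (2 * Fintype.card d *
            (Fintype.card d * (2 ^ latOrder d * latMass d * (ρ * (2 * π * ρ) + ρ * (2 * π * ρ))) +
              Fintype.card d * (2 ^ latOrder d * latMass d * (A * (2 * π * ρ) + A * (2 * π * ρ))) +
              Fintype.card d * (2 ^ latOrder d * latMass d * (ρ * (2 * π * A) + ρ * (2 * π * A))) +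
              Fintype.card d * (2 * π * B))) ≤ ρ ∧
      (Real.exp 1 * (1 + 1 / (2 * Real.sqrt (4 * π ^ 2 * 1))) * Real.sqrt θ) *
          (2 * Fintype.card d *
            (Fintype.card d * (2 ^ latOrder d * latMass d * (2 * π)) * (4 * ρ + 4 * A))) ≤ 1 / 2 := by
  set E : ℝ := Real.exp 1 * (1 + 1 / (2 * Real.sqrt (4 * π ^ 2 * 1))) with hE
  set Cb : ℝ := 2 * Fintype.card d *
    (Fintype.card d * (2 ^ latOrder d * latMass d * (ρ * (2 * π * ρ) + ρ * (2 * π * ρ))) +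
      Fintype.card d * (2 ^ latOrder d * latMass d * (A * (2 * π * ρ) + A * (2 * π * ρ))) +
      Fintype.card d * (2 ^ latOrder d * latMass d * (ρ * (2 * π * A) + ρ * (2 * π * A))) +
      Fintype.card d * (2 * π * B)) with hCb
  set L : ℝ := 2 * Fintype.card d *
    (Fintype.card d * (2 ^ latOrder d * latMass d * (2 * π)) * (4 * ρ + 4 * A)) with hL
  have hlm := latMass_nonneg (d := d)
  have hE0 : 0 ≤ E := by positivity
  have hCb0 : 0 ≤ Cb := by positivity
  have hL0 : 0 ≤ L := by positivity
  set M : ℝ := max (E * Cb / ρ) (2 * E * L) with hM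
  have hM0 : 0 ≤ M := le_max_of_le_right (by positivity)
  have hM1 : 0 < M + 1 := by linarith
  refine ⟨min 1 ((1 / (M + 1)) ^ 2), lt_min one_pos (by positivity), min_le_left _ _, ?_⟩
  intro θ hθ hθle
  have hsq : Real.sqrt θ ≤ 1 / (M + 1) := by
    rw [Real.sqrt_le_left (by positivity)]
    exact hθle.trans (min_le_right _ _)
  have h1 : E * Real.sqrt θ * Cb ≤ E * Cb / (M + 1) := by
    calc E * Real.sqrt θ * Cb = E * Cb * Real.sqrt θ := by ring
      _ ≤ E * Cb * (1 / (M + 1)) := mul_le_mul_of_nonneg_left hsq (by positivity)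
      _ = E * Cb / (M + 1) := by ring
  have h2 : E * Real.sqrt θ * L ≤ E * L / (M + 1) := by
    calc E * Real.sqrt θ * L = E * L * Real.sqrt θ := by ring
      _ ≤ E * L * (1 / (M + 1)) := mul_le_mul_of_nonneg_left hsq (by positivity)
      _ = E * L / (M + 1) := by ring
  constructor
  · refine h1.trans ?_
    rw [div_le_iff₀ hM1]
    have : E * Cb / ρ ≤ M := le_max_left _ _
    rw [div_le_iff₀ hρ] at this
    nlinarith
  · refine h2.trans ?_
    rw [div_le_iff₀ hM1]
    have : 2 * E * L ≤ M := le_max_right _ _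
    nlinarith

/-- **The iteration estimates on a short interval.** If the interval length is below the
threshold of `exists_threshold` for the radius `ρ` and the data constants, then every iterate
`cₙ` is continuous in time, lies in the ball of radius `ρ` at order `2#d + 1`, and
`‖cₙ₊₁ - cₙ‖ ≤ ρ 2^{-n} (1+‖k‖)^{-(2#d+1)}` (Picard's successive approximations; Leray 1934,
§19, for the Navier–Stokes twin). [folklore] -/
theorem DataHyp.iter_estimates (h : DataHyp θ U RH) {ρ A B : ℝ} (hρ : 0 ≤ ρ) (hA : 0 ≤ A)
    (hB : 0 ≤ B) (hU : ∀ j t, HasDecay (latOrder d + 1) A (U j t))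
    (hR : ∀ i j t, HasDecay (latOrder d + 1) B (RH i j t))
    (hS1 : (Real.exp 1 * (1 + 1 / (2 * Real.sqrt (4 * π ^ 2 * 1))) * Real.sqrt θ) *
      (2 * Fintype.card d *
        (Fintype.card d * (2 ^ latOrder d * latMass d * (ρ * (2 * π * ρ) + ρ * (2 * π * ρ))) +
          Fintype.card d * (2 ^ latOrder d * latMass d * (A * (2 * π * ρ) + A * (2 * π * ρ))) +
          Fintype.card d * (2 ^ latOrder d * latMass d * (ρ * (2 * π * A) + ρ * (2 * π * A))) +
          Fintype.card d * (2 * π * B))) ≤ ρ)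
    (hS2 : (Real.exp 1 * (1 + 1 / (2 * Real.sqrt (4 * π ^ 2 * 1))) * Real.sqrt θ) *
      (2 * Fintype.card d *
        (Fintype.card d * (2 ^ latOrder d * latMass d * (2 * π)) * (4 * ρ + 4 * A))) ≤ 1 / 2)
    (n : ℕ) :
    (∀ l m, Continuous fun t => picardIter θ U RH n l t m) ∧
    (∀ l t, HasDecay (latOrder d + 1) ρ (picardIter θ U RH n l t)) ∧
    (∀ l t, HasDecay (latOrder d + 1) (ρ * (1 / 2) ^ n)
      (fun m => picardIter θ U RH (n + 1) l t m - picardIter θ U RH n l t m)) := by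
  induction n with
  | zero =>
    have hzero : ∀ l t, HasDecay (latOrder d + 1) ρ (picardIter θ U RH 0 l t) := by
      intro l t m; simp only [picardIter_zero, norm_zero]; positivity
    refine ⟨fun l m => ?_, hzero, fun l t => ?_⟩
    · simpa using continuous_const
    · have h1 := h.hasDecay_picardMap hA hB hρ hU hR hzero l t
      simp only [picardIter_succ, picardIter_zero, sub_zero, pow_zero, mul_one]
      exact h1.mono hS1
  | succ n ih =>
    obtain ⟨hcont, hball, hdiff⟩ := ih
    have hcont' : ∀ l m, Continuous fun t => picardIter θ U RH (n + 1) l t m := fun l m => by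
      simp only [picardIter_succ]
      exact h.continuous_picardMap hU hcont hball l m
    have hball' : ∀ l t, HasDecay (latOrder d + 1) ρ (picardIter θ U RH (n + 1) l t) := fun l t => by
      simp only [picardIter_succ]
      exact (h.hasDecay_picardMap hA hB hρ hU hR hball l t).mono hS1
    refine ⟨hcont', hball', fun l t => ?_⟩
    have key := h.hasDecay_picardMap_sub hA hρ (by positivity : 0 ≤ ρ * (1 / 2) ^ n) hU hcont' hcont
      hball' hball hdiff l t
    simp only [picardIter_succ] at key ⊢
    refine key.mono ?_
    have hw : 0 ≤ ρ * (1 / 2) ^ n := by positivity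
    calc _ = (Real.exp 1 * (1 + 1 / (2 * Real.sqrt (4 * π ^ 2 * 1))) * Real.sqrt θ) *
          (2 * Fintype.card d *
            (Fintype.card d * (2 ^ latOrder d * latMass d * (2 * π)) * (4 * ρ + 4 * A))) *
          (ρ * (1 / 2) ^ n) := by ring
      _ ≤ 1 / 2 * (ρ * (1 / 2) ^ n) := mul_le_mul_of_nonneg_right hS2 hw
      _ = ρ * (1 / 2) ^ (n + 1) := by ring

/-- **Convergence of the Picard iteration on a short interval with all estimates**: under the
threshold, the iterates are continuous in time and in the ball of radius `ρ`, converge to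
`c = picardLim` with `‖cₙ - c‖ ≤ 2ρ 2^{-n} (1+‖k‖)^{-(2#d+1)}` uniformly in `(l, t)`, and the
limit lies in the ball (geometric series; Mathlib `cauchySeq_of_le_geometric`,
`dist_le_of_le_geometric_of_tendsto`). [folklore] -/
theorem DataHyp.iter_tendsto (h : DataHyp θ U RH) {ρ A B : ℝ} (hρ : 0 ≤ ρ) (hA : 0 ≤ A)
    (hB : 0 ≤ B) (hU : ∀ j t, HasDecay (latOrder d + 1) A (U j t))
    (hR : ∀ i j t, HasDecay (latOrder d + 1) B (RH i j t))
    (hS1 : (Real.exp 1 * (1 + 1 / (2 * Real.sqrt (4 * π ^ 2 * 1))) * Real.sqrt θ) *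
      (2 * Fintype.card d *
        (Fintype.card d * (2 ^ latOrder d * latMass d * (ρ * (2 * π * ρ) + ρ * (2 * π * ρ))) +
          Fintype.card d * (2 ^ latOrder d * latMass d * (A * (2 * π * ρ) + A * (2 * π * ρ))) +
          Fintype.card d * (2 ^ latOrder d * latMass d * (ρ * (2 * π * A) + ρ * (2 * π * A))) +
          Fintype.card d * (2 * π * B))) ≤ ρ)
    (hS2 : (Real.exp 1 * (1 + 1 / (2 * Real.sqrt (4 * π ^ 2 * 1))) * Real.sqrt θ) *
      (2 * Fintype.card d *
        (Fintype.card d * (2 ^ latOrder d * latMass d * (2 * π)) * (4 * ρ + 4 * A))) ≤ 1 / 2) :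
    (∀ n l m, Continuous fun t => picardIter θ U RH n l t m) ∧
    (∀ n l t, HasDecay (latOrder d + 1) ρ (picardIter θ U RH n l t)) ∧
    (∀ l t m, Tendsto (fun n => picardIter θ U RH n l t m) atTop (𝓝 (picardLim θ U RH l t m))) ∧
    (∀ n l t, HasDecay (latOrder d + 1) (2 * ρ * (1 / 2) ^ n)
      (fun m => picardIter θ U RH n l t m - picardLim θ U RH l t m)) ∧
    (∀ l t, HasDecay (latOrder d + 1) ρ (picardLim θ U RH l t)) := by
  have hest := h.iter_estimates hρ hA hB hU hR hS1 hS2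
  have hstep : ∀ l t m n, dist (picardIter θ U RH n l t m) (picardIter θ U RH (n + 1) l t m) ≤
      ρ * ((1 + ‖m‖) ^ (latOrder d + 1))⁻¹ * (1 / 2) ^ n := by
    intro l t m n
    rw [dist_eq_norm, norm_sub_rev]
    have h1 := (hest n).2.2 l t m
    calc _ ≤ ρ * (1 / 2) ^ n * ((1 + ‖m‖) ^ (latOrder d + 1))⁻¹ := h1
      _ = _ := by ring
  have hcauchy : ∀ l t m, CauchySeq fun n => picardIter θ U RH n l t m := fun l t m =>
    cauchySeq_of_le_geometric (1 / 2) _ (by norm_num) (hstep l t m)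
  have htend : ∀ l t m, Tendsto (fun n => picardIter θ U RH n l t m) atTop
      (𝓝 (picardLim θ U RH l t m)) := fun l t m => (hcauchy l t m).tendsto_limUnder
  have herr : ∀ n l t m, ‖picardIter θ U RH n l t m - picardLim θ U RH l t m‖ ≤
      2 * ρ * (1 / 2) ^ n * ((1 + ‖m‖) ^ (latOrder d + 1))⁻¹ := by
    intro n l t m
    have h1 := dist_le_of_le_geometric_of_tendsto (1 / 2) _ (by norm_num) (hstep l t m) (htend l t m) n
    rw [dist_eq_norm] at h1
    refine h1.trans_eq ?_
    ring
  refine ⟨fun n => (hest n).1, fun n => (hest n).2.1, htend, fun n l t m => herr n l t m, fun l t m => ?_⟩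
  -- the limit stays in the closed ball
  refine le_of_tendsto ((continuous_norm.tendsto _).comp (htend l t m)) (Eventually.of_forall fun n => ?_)
  exact (hest n).2.1 l t m

/-- **The Picard limit is continuous in time** at each component and frequency (uniform limit of
continuous functions, Mathlib `TendstoUniformly.continuous`). [folklore] -/
theorem DataHyp.continuous_picardLim (h : DataHyp θ U RH) {ρ A B : ℝ} (hρ : 0 ≤ ρ) (hA : 0 ≤ A)
    (hB : 0 ≤ B) (hU : ∀ j t, HasDecay (latOrder d + 1) A (U j t))
    (hR : ∀ i j t, HasDecay (latOrder d + 1) B (RH i j t))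
    (hS1 : (Real.exp 1 * (1 + 1 / (2 * Real.sqrt (4 * π ^ 2 * 1))) * Real.sqrt θ) *
      (2 * Fintype.card d *
        (Fintype.card d * (2 ^ latOrder d * latMass d * (ρ * (2 * π * ρ) + ρ * (2 * π * ρ))) +
          Fintype.card d * (2 ^ latOrder d * latMass d * (A * (2 * π * ρ) + A * (2 * π * ρ))) +
          Fintype.card d * (2 ^ latOrder d * latMass d * (ρ * (2 * π * A) + ρ * (2 * π * A))) +
          Fintype.card d * (2 * π * B))) ≤ ρ)
    (hS2 : (Real.exp 1 * (1 + 1 / (2 * Real.sqrt (4 * π ^ 2 * 1))) * Real.sqrt θ) *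
      (2 * Fintype.card d *
        (Fintype.card d * (2 ^ latOrder d * latMass d * (2 * π)) * (4 * ρ + 4 * A))) ≤ 1 / 2)
    (l : d) (m : d → ℤ) : Continuous fun t => picardLim θ U RH l t m := by
  obtain ⟨hcont, -, -, herr, -⟩ := h.iter_tendsto hρ hA hB hU hR hS1 hS2
  have hunif : TendstoUniformly (fun n t => picardIter θ U RH n l t m)
      (fun t => picardLim θ U RH l t m) atTop := by
    refine Metric.tendstoUniformly_iff.2 fun ε hε => ?_
    have hgeo : Tendsto (fun n : ℕ => 2 * ρ * (1 / 2 : ℝ) ^ n) atTop (𝓝 0) := by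
      have := tendsto_pow_atTop_nhds_zero_of_lt_one (r := (1 / 2 : ℝ)) (by norm_num) (by norm_num)
      simpa using this.const_mul (2 * ρ)
    filter_upwards [(tendsto_order.1 hgeo).2 ε hε] with n hn t
    rw [dist_comm, dist_eq_norm]
    have h1 := herr n l t m
    have hw : ((1 + ‖m‖) ^ (latOrder d + 1))⁻¹ ≤ 1 := FourierNS.inv_one_add_norm_pow_le_one m _
    have h2ρ : 0 ≤ 2 * ρ * (1 / 2 : ℝ) ^ n := by positivity
    calc _ ≤ 2 * ρ * (1 / 2) ^ n * ((1 + ‖m‖) ^ (latOrder d + 1))⁻¹ := h1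
      _ ≤ 2 * ρ * (1 / 2) ^ n * 1 := mul_le_mul_of_nonneg_left hw h2ρ
      _ < ε := by rw [mul_one]; exact hn
  exact hunif.continuous (Frequently.of_forall fun n => hcont n l m)

/-- **The Picard limit is a fixed point of the Duhamel map on a short interval**: `c = Φ(c)`,
i.e. the mild equation `c(l,t,k) = -∫₀^τ e^{-4π²|k|²(τ-s)} (P G)(U(s), RH(s), c(s))(l,k) ds`,
`τ = clamp θ t`. [folklore] -/
theorem DataHyp.picardLim_eq_picardMap (h : DataHyp θ U RH) {ρ A B : ℝ} (hρ : 0 ≤ ρ) (hA : 0 ≤ A)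
    (hB : 0 ≤ B) (hU : ∀ j t, HasDecay (latOrder d + 1) A (U j t))
    (hR : ∀ i j t, HasDecay (latOrder d + 1) B (RH i j t))
    (hS1 : (Real.exp 1 * (1 + 1 / (2 * Real.sqrt (4 * π ^ 2 * 1))) * Real.sqrt θ) *
      (2 * Fintype.card d *
        (Fintype.card d * (2 ^ latOrder d * latMass d * (ρ * (2 * π * ρ) + ρ * (2 * π * ρ))) +
          Fintype.card d * (2 ^ latOrder d * latMass d * (A * (2 * π * ρ) + A * (2 * π * ρ))) +
          Fintype.card d * (2 ^ latOrder d * latMass d * (ρ * (2 * π * A) + ρ * (2 * π * A))) +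
          Fintype.card d * (2 * π * B))) ≤ ρ)
    (hS2 : (Real.exp 1 * (1 + 1 / (2 * Real.sqrt (4 * π ^ 2 * 1))) * Real.sqrt θ) *
      (2 * Fintype.card d *
        (Fintype.card d * (2 ^ latOrder d * latMass d * (2 * π)) * (4 * ρ + 4 * A))) ≤ 1 / 2)
    (l : d) (t : ℝ) (k : d → ℤ) :
    picardLim θ U RH l t k = picardMap θ U RH (picardLim θ U RH) l t k := by
  obtain ⟨hcont, hball, -, herr, hlimball⟩ := h.iter_tendsto hρ hA hB hU hR hS1 hS2
  set c := picardLim θ U RH with hc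
  have hcc : ∀ l m, Continuous fun t => c l t m := h.continuous_picardLim hρ hA hB hU hR hS1 hS2
  have hbound : ∀ n : ℕ, ‖picardMap θ U RH c l t k - c l t k‖ ≤
      (1 / 2 * (2 * ρ * (1 / 2) ^ n) + 2 * ρ * (1 / 2) ^ (n + 1)) * ((1 + ‖k‖) ^ (latOrder d + 1))⁻¹ := by
    intro n
    have hdiff : ∀ l t, HasDecay (latOrder d + 1) (2 * ρ * (1 / 2) ^ n)
        (fun m => c l t m - picardIter θ U RH n l t m) := by
      intro l t m
      have h1 := herr n l t m
      rwa [norm_sub_rev] at h1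
    have key := h.hasDecay_picardMap_sub hA hρ (by positivity) hU hcc (hcont n) hlimball (hball n)
      hdiff l t k
    rw [← picardIter_succ] at key
    have h2 := herr (n + 1) l t k
    have hw : 0 ≤ 2 * ρ * (1 / 2 : ℝ) ^ n := by positivity
    calc ‖picardMap θ U RH c l t k - c l t k‖
        ≤ ‖picardMap θ U RH c l t k - picardIter θ U RH (n + 1) l t k‖ +
          ‖picardIter θ U RH (n + 1) l t k - c l t k‖ := norm_sub_le_norm_sub_add_norm_sub _ _ _
      _ ≤ (Real.exp 1 * (1 + 1 / (2 * Real.sqrt (4 * π ^ 2 * 1))) * Real.sqrt θ) *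
            (2 * Fintype.card d *
              (Fintype.card d * (2 ^ latOrder d * latMass d * (2 * π)) * (4 * ρ + 4 * A))) *
            (2 * ρ * (1 / 2) ^ n) * ((1 + ‖k‖) ^ (latOrder d + 1))⁻¹ +
          2 * ρ * (1 / 2) ^ (n + 1) * ((1 + ‖k‖) ^ (latOrder d + 1))⁻¹ := add_le_add key h2
      _ ≤ 1 / 2 * (2 * ρ * (1 / 2) ^ n) * ((1 + ‖k‖) ^ (latOrder d + 1))⁻¹ +
          2 * ρ * (1 / 2) ^ (n + 1) * ((1 + ‖k‖) ^ (latOrder d + 1))⁻¹ := by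
            gcongr
      _ = _ := by ring
  have hlim : Tendsto (fun n : ℕ => (1 / 2 * (2 * ρ * (1 / 2 : ℝ) ^ n) + 2 * ρ * (1 / 2) ^ (n + 1)) *
      ((1 + ‖k‖) ^ (latOrder d + 1))⁻¹) atTop (𝓝 0) := by
    have hg := tendsto_pow_atTop_nhds_zero_of_lt_one (r := (1 / 2 : ℝ)) (by norm_num) (by norm_num)
    have e : (fun n : ℕ => (1 / 2 * (2 * ρ * (1 / 2 : ℝ) ^ n) + 2 * ρ * (1 / 2) ^ (n + 1)) *
        ((1 + ‖k‖) ^ (latOrder d + 1))⁻¹) = fun n => (2 * ρ * ((1 + ‖k‖) ^ (latOrder d + 1))⁻¹) * (1 / 2 : ℝ) ^ n := by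
      funext n; ring
    rw [e]
    simpa using hg.const_mul (2 * ρ * ((1 + ‖k‖) ^ (latOrder d + 1))⁻¹)
  have h0 : ‖picardMap θ U RH c l t k - c l t k‖ ≤ 0 := ge_of_tendsto' hlim fun n => hbound n
  have := norm_le_zero_iff.1 h0
  rw [sub_eq_zero] at this
  exact this.symm

omit [DecidableEq d] in
/-- The clamped time vanishes at nonpositive times. [folklore] -/
theorem clamp_of_nonpos (θ : ℝ) {t : ℝ} (ht : t ≤ 0) : clamp θ t = 0 := by
  rw [FourierNS.clamp]
  exact le_antisymm (max_le le_rfl ((min_le_left _ _).trans ht)) (le_max_left _ _)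

/-- The Duhamel map vanishes at nonpositive times (zero datum): `Φ(c)(l, t, k) = 0` for `t ≤ 0`. [folklore] -/
theorem picardMap_of_nonpos (c : d → ℝ → (d → ℤ) → ℂ) (l : d) {t : ℝ} (ht : t ≤ 0)
    (k : d → ℤ) : picardMap θ U RH c l t k = 0 := by
  simp [picardMap, clamp_of_nonpos θ ht]

/-- **The Picard limit vanishes at time zero** (and before): `c(l, t, k) = 0` for `t ≤ 0`. [folklore] -/
theorem DataHyp.picardLim_of_nonpos (h : DataHyp θ U RH) {ρ A B : ℝ} (hρ : 0 ≤ ρ) (hA : 0 ≤ A)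
    (hB : 0 ≤ B) (hU : ∀ j t, HasDecay (latOrder d + 1) A (U j t))
    (hR : ∀ i j t, HasDecay (latOrder d + 1) B (RH i j t))
    (hS1 : (Real.exp 1 * (1 + 1 / (2 * Real.sqrt (4 * π ^ 2 * 1))) * Real.sqrt θ) *
      (2 * Fintype.card d *
        (Fintype.card d * (2 ^ latOrder d * latMass d * (ρ * (2 * π * ρ) + ρ * (2 * π * ρ))) +
          Fintype.card d * (2 ^ latOrder d * latMass d * (A * (2 * π * ρ) + A * (2 * π * ρ))) +
          Fintype.card d * (2 ^ latOrder d * latMass d * (ρ * (2 * π * A) + ρ * (2 * π * A))) +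
          Fintype.card d * (2 * π * B))) ≤ ρ)
    (hS2 : (Real.exp 1 * (1 + 1 / (2 * Real.sqrt (4 * π ^ 2 * 1))) * Real.sqrt θ) *
      (2 * Fintype.card d *
        (Fintype.card d * (2 ^ latOrder d * latMass d * (2 * π)) * (4 * ρ + 4 * A))) ≤ 1 / 2)
    (l : d) {t : ℝ} (ht : t ≤ 0) (k : d → ℤ) : picardLim θ U RH l t k = 0 := by
  rw [h.picardLim_eq_picardMap hρ hA hB hU hR hS1 hS2 l t k, picardMap_of_nonpos _ l ht]

end Iteration

end CorrectorFourier

end Literature.Analysis.FluidPDE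

end
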